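import Literature.NumberTheory.Automorphic.LocalUnitaryIntegralLevelCongrSplit   -- `eventually_exists_cmDatumLocalCongr_levelMatching_all_three` (cofinite level-matching form congruences)
import Literature.NumberTheory.Automorphic.LocalUnitaryGroupSimilitude           -- `exists_isUnit_formCongr_cmDatum_antidiagThree`, `corresponds_cmDatumLocalCongr[_symm]`
import HarnessLib

/-!
# ONE family `ψ_v : U(H)(L⁺_v) ≅ U(Φ₃)(L⁺_v)` of FORM CONGRUENCES — `ψ_v = (g ↦ T_v⁻¹ g T_v)` with `ᵗ(T̄_v) H T_v = a_v Φ₃` at EVERY finite place,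
# level-matching at almost every place (Rogawski (1990), §14.1–14.2 pp. 232–233; Platonov–Rapinchuk (1994), §2.3)

Topic `NumberTheory/Automorphic`; namespace `Literature.NumberTheory.Automorphic.UnitaryGroup`.  THEOREMS ONLY (no definition, no instance, no
named fact, no notation, no `sorry`).

WHAT.  ★ `exists_psi_conj_forall_levelMatching` (`LocalUnitaryGroupSimilitudeLevel` §4) and its reading ★
`exists_psi_conj_corresponds_forall_levelMatching` (`Rogawski1990/PureTensorCentralValues`) export the inner isomorphisms `ψ_v` of Rogawski's §14.1
(«we fix an inner isomorphism `ψ : G′ → G`») only in the CONJUGATION shape `∃ S ∈ GL₃(L ⊗ L⁺_v), ψ_v g = S⁻¹ g S`, forgetting that `S` is a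
SIMILITUDE between the hermitian forms (`ᵗS̄ H S = a Φ₃`).  This file re-runs the same construction KEEPING the similitude: at every finite `v`
the isomorphism IS the inverse of a form congruence ★ `cmDatumLocalCongr L v T ha h : U(Φ₃)_v ≃ₜ* U(H)_v` (★ `LocalUnitaryGroupCongr`, `g ↦ T g T⁻¹`
for `ᵗ(T̄) H_v T = a • Φ₃`), chosen LEVEL-MATCHING wherever a level-matching congruence exists — which is almost everywhere (★
`eventually_exists_cmDatumLocalCongr_levelMatching_all_three`, split places included) — and given by the everywhere similitude ★
`exists_isUnit_formCongr_cmDatum_antidiagThree` at the finitely many remaining places.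
* §1 **`exists_psi_congr_forall_levelMatching (hanis) (hherm)`**: `∃ ψ S₀, (∀ v, ∃ T a ha h, ψ v = (cmDatumLocalCongr L v T ha h).symm) ∧
  ∀ v ∉ S₀, ∀ g, ψ v g ∈ U(Φ₃)(𝒪_v) ↔ g ∈ U(H)(𝒪_v)`.
* §2 readings for consumers keyed on the older shapes: `exists_psi_congr_conj_corresponds_forall_levelMatching` — the same `ψ` with, in addition,
  the conjugation reading `(ψ v g).val = T⁻¹ * g.val * T` (so every consumer of the `∃ S` shape is served) and the two stable-conjugacy readings
  `γ′ ↔ ψ_v γ′`, `ψ_v⁻¹ γ ↔ γ` (★ `corresponds_cmDatumLocalCongr[_symm]`) — the conclusion of ★ `exists_psi_conj_corresponds_forall_levelMatching`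
  token for token PLUS the congruence clause.
WHY (consumer).  Transport of unramified Hecke eigenvalues along `ψ_v` («`t_v` can be regarded as an e.v.p. on either `G′` or `G`», §14.6 p. 242
l. 10–12) is proved in the tree along FORM CONGRUENCES (pull-back of the unramified member along every level-matching `cmDatumLocalCongr`); a
comparison kit pinned only by the conjugation shape cannot use it without the extra fact «`S⁻¹ U(H)_v S ⊆ U(Φ₃)_v` forces `S` to be a similitude»
(uniqueness of the `U(H)(L⁺_v)`-invariant hermitian form).  With this file a kit may pin `ψ` in the congruence shape instead, satisfiable by the
same construction.  (Cell `hodgecm-mathlib`, programme R90-TF, section S9; S9 dealer R90-IF-plan (g3) ruling S9-R-FC-1 2026-09-05T04:24:50Z, road (E1);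
`--supports stmt-HodgeConjecture-24833`; HC_CM is proved only modulo the printed citations until rung 0 closes.)

## Tree search
`lean search 'psi_congr|PsiCongr'`: nothing.  ★ by name: `cmDatumLocalCongr`, `coe_cmDatumLocalCongr_apply` (`LocalUnitaryGroupCongr`);
`exists_isUnit_formCongr_cmDatum_antidiagThree`, `corresponds_cmDatumLocalCongr`, `corresponds_cmDatumLocalCongr_symm`, `exists_cmDatum_localEquiv_corresponds`
(`LocalUnitaryGroupSimilitude` — the everywhere frame, already `(cmDatumLocalCongr …).symm` inside its proof); `eventually_exists_cmDatumLocalCongr_levelMatching_all_three`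
(`LocalUnitaryIntegralLevelCongrSplit`); `Godement.det_ne_zero_of_anisotropic`.

## References
* [Rogawski1990] J. Rogawski, *Automorphic Representations of Unitary Groups in Three Variables*, Ann. of Math. Stud. 123 (1990), §14.1–14.2 pp. 232–233, §14.6 p. 242.
* [PlatonovRapinchuk1994] V. Platonov, A. Rapinchuk, *Algebraic Groups and Number Theory* (1994), §2.3, §5.1.
-/

set_option autoImplicit false

noncomputable section

open NumberField IsDedekindDomain Filter
open Literature.AlgebraicGeometry.ShimuraVarieties (hermForm)
open Literature.NumberTheory.Rogawski1990 (Corresponds corresponds_comm)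
open scoped Matrix MatrixGroups

namespace Literature.NumberTheory.Automorphic

namespace UnitaryGroup

variable (L : Type) [Field L] [NumberField L] [IsCMField L]

/-! ## §1 The form-congruence family -/

/-- **ONE FAMILY OF FORM CONGRUENCES `ψ_v : U(H)(L⁺_v) ≃ₜ* U(Φ₃)(L⁺_v)`, LEVEL-MATCHING OFF A FINITE SET.**  For `H ∈ M₃(L)` anisotropic and hermitian
there are `ψ = (ψ_v)_v` and a finite `S₀` such that (i) at EVERY finite place `ψ_v = (cmDatumLocalCongr L v T ha h)⁻¹` for a similitude `T ∈ GL₃(L ⊗ L⁺_v)`,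
`ᵗ(T̄) H_v T = a • Φ₃` (`a` a unit) — i.e. `ψ_v g = T⁻¹ g T` WITH the similitude relation kept — and (ii) for `v ∉ S₀`, `ψ_v` carries `U(H)(𝒪_v)` onto
`U(Φ₃)(𝒪_v)`.  Construction: at the cofinitely many places with a level-matching congruence (★ `eventually_exists_cmDatumLocalCongr_levelMatching_all_three`)
take one; elsewhere take the everywhere similitude (★ `exists_isUnit_formCongr_cmDatum_antidiagThree`); `S₀` = the exceptional finite set.
[cite: Rogawski1990, §14.1–14.2 pp. 232–233] -/
theorem exists_psi_congr_forall_levelMatching (H : Matrix (Fin 3) (Fin 3) L)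
    (hanis : ∀ x : Fin 3 → L, hermForm (cmConjRingHom L) H x x = 0 → x = 0) (hherm : (H.map (cmConjRingHom L))ᵀ = H) :
    ∃ (ψ : ∀ v : HeightOneSpectrum (𝓞 ↥(maximalRealSubfield L)), (cmDatum L 3 H).Local v ≃ₜ*
        (cmDatum L 3 (Matrix.of fun i j : Fin 3 => if i.val + j.val + 1 = 3 then (1 : L) else 0)).Local v)
      (S₀ : Finset (HeightOneSpectrum (𝓞 ↥(maximalRealSubfield L)))),
      (∀ v, ∃ (T : GL (Fin 3) (LocalRing L v)) (a : LocalRing L v) (ha : IsUnit a)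
        (h : formCongr (conjLocal L (IsCMField.complexConj L) v) T (H.map (algebraMap L (LocalRing L v))) =
          a • (Matrix.of fun i j : Fin 3 => if i.val + j.val + 1 = 3 then (1 : L) else 0).map (algebraMap L (LocalRing L v))),
        ψ v = (cmDatumLocalCongr L v T ha h).symm) ∧
      ∀ v ∉ S₀, ∀ g, ψ v g ∈ cmLocalIntegralLevel L 3 (Matrix.of fun i j : Fin 3 => if i.val + j.val + 1 = 3 then (1 : L) else 0) v ↔
        g ∈ cmLocalIntegralLevel L 3 H v := by
  classical
  have hHd : IsUnit H.det := isUnit_iff_ne_zero.2 (Godement.det_ne_zero_of_anisotropic L H hanis)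
  have hev := eventually_exists_cmDatumLocalCongr_levelMatching_all_three L H hherm hHd
  rw [Filter.eventually_cofinite] at hev
  -- at every place: a similitude frame, level-matching whenever a level-matching one exists
  have hframe : ∀ v : HeightOneSpectrum (𝓞 ↥(maximalRealSubfield L)),
      ∃ (T : GL (Fin 3) (LocalRing L v)) (a : LocalRing L v) (ha : IsUnit a)
        (h : formCongr (conjLocal L (IsCMField.complexConj L) v) T (H.map (algebraMap L (LocalRing L v))) =
          a • (Matrix.of fun i j : Fin 3 => if i.val + j.val + 1 = 3 then (1 : L) else 0).map (algebraMap L (LocalRing L v))),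
        (∃ (T₁ : GL (Fin 3) (LocalRing L v)) (a₁ : LocalRing L v) (ha₁ : IsUnit a₁)
            (h₁ : formCongr (conjLocal L (IsCMField.complexConj L) v) T₁ (H.map (algebraMap L (LocalRing L v))) =
              a₁ • (Matrix.of fun i j : Fin 3 => if i.val + j.val + 1 = 3 then (1 : L) else 0).map (algebraMap L (LocalRing L v))),
            ∀ g : (cmDatum L 3 H).Local v,
              (cmDatumLocalCongr L v T₁ ha₁ h₁).symm g ∈
                  cmLocalIntegralLevel L 3 (Matrix.of fun i j : Fin 3 => if i.val + j.val + 1 = 3 then (1 : L) else 0) v ↔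
                g ∈ cmLocalIntegralLevel L 3 H v) →
          ∀ g : (cmDatum L 3 H).Local v,
            (cmDatumLocalCongr L v T ha h).symm g ∈
                cmLocalIntegralLevel L 3 (Matrix.of fun i j : Fin 3 => if i.val + j.val + 1 = 3 then (1 : L) else 0) v ↔
              g ∈ cmLocalIntegralLevel L 3 H v := by
    intro v
    by_cases hv : ∃ (T₁ : GL (Fin 3) (LocalRing L v)) (a₁ : LocalRing L v) (ha₁ : IsUnit a₁)
        (h₁ : formCongr (conjLocal L (IsCMField.complexConj L) v) T₁ (H.map (algebraMap L (LocalRing L v))) =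
          a₁ • (Matrix.of fun i j : Fin 3 => if i.val + j.val + 1 = 3 then (1 : L) else 0).map (algebraMap L (LocalRing L v))),
        ∀ g : (cmDatum L 3 H).Local v,
          (cmDatumLocalCongr L v T₁ ha₁ h₁).symm g ∈
              cmLocalIntegralLevel L 3 (Matrix.of fun i j : Fin 3 => if i.val + j.val + 1 = 3 then (1 : L) else 0) v ↔
            g ∈ cmLocalIntegralLevel L 3 H v
    · obtain ⟨T, a, ha, h, hl⟩ := hv
      exact ⟨T, a, ha, h, fun _ => hl⟩
    · obtain ⟨T, a, ha, -, h⟩ := exists_isUnit_formCongr_cmDatum_antidiagThree L H hanis hherm v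
      exact ⟨T, a, ha, h, fun h' => absurd h' hv⟩
  choose T a ha h hl using hframe
  refine ⟨fun v => (cmDatumLocalCongr L v (T v) (ha v) (h v)).symm, hev.toFinset, fun v => ⟨T v, a v, ha v, h v, rfl⟩, fun v hv g => ?_⟩
  have hgood : ∃ (T₁ : GL (Fin 3) (LocalRing L v)) (a₁ : LocalRing L v) (ha₁ : IsUnit a₁)
      (h₁ : formCongr (conjLocal L (IsCMField.complexConj L) v) T₁ (H.map (algebraMap L (LocalRing L v))) =
        a₁ • (Matrix.of fun i j : Fin 3 => if i.val + j.val + 1 = 3 then (1 : L) else 0).map (algebraMap L (LocalRing L v))),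
      ∀ g : (cmDatum L 3 H).Local v,
        (cmDatumLocalCongr L v T₁ ha₁ h₁).symm g ∈
            cmLocalIntegralLevel L 3 (Matrix.of fun i j : Fin 3 => if i.val + j.val + 1 = 3 then (1 : L) else 0) v ↔
          g ∈ cmLocalIntegralLevel L 3 H v := by
    by_contra hbad
    exact hv (hev.mem_toFinset.2 hbad)
  exact hl v hgood g

/-! ## §2 The readings consumers key on: conjugation shape and stable-conjugacy correspondences -/

/-- **THE SAME FAMILY WITH ALL READINGS** — form congruence at every place (`ψ_v = (cmDatumLocalCongr L v T ha h)⁻¹`), hence the conjugation reading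
`(ψ_v g).val = T⁻¹ * g.val * T` (definitional), hence `γ′ ↔ ψ_v γ′` and `ψ_v⁻¹ γ ↔ γ` (★ `corresponds_cmDatumLocalCongr_symm` ∕ `corresponds_cmDatumLocalCongr`),
and level matching off `S₀`: the conclusion of ★ `exists_psi_conj_corresponds_forall_levelMatching` with the similitude clause added.
[cite: Rogawski1990, §14.1–14.2 (14.2.1) pp. 232–233] -/
theorem exists_psi_congr_conj_corresponds_forall_levelMatching (H : Matrix (Fin 3) (Fin 3) L)
    (hanis : ∀ x : Fin 3 → L, hermForm (cmConjRingHom L) H x x = 0 → x = 0) (hherm : (H.map (cmConjRingHom L))ᵀ = H) :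
    ∃ (ψ : ∀ v : HeightOneSpectrum (𝓞 ↥(maximalRealSubfield L)), (cmDatum L 3 H).Local v ≃ₜ*
        (cmDatum L 3 (Matrix.of fun i j : Fin 3 => if i.val + j.val + 1 = 3 then (1 : L) else 0)).Local v)
      (S₀ : Finset (HeightOneSpectrum (𝓞 ↥(maximalRealSubfield L)))),
      (∀ v, ∃ (T : GL (Fin 3) (LocalRing L v)) (a : LocalRing L v) (ha : IsUnit a)
        (h : formCongr (conjLocal L (IsCMField.complexConj L) v) T (H.map (algebraMap L (LocalRing L v))) =
          a • (Matrix.of fun i j : Fin 3 => if i.val + j.val + 1 = 3 then (1 : L) else 0).map (algebraMap L (LocalRing L v))),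
        ψ v = (cmDatumLocalCongr L v T ha h).symm ∧
          ∀ g : (cmDatum L 3 H).Local v, ((ψ v g).val : GL (Fin 3) (LocalRing L v)) = T⁻¹ * g.val * T) ∧
      (∀ v, ∃ S : GL (Fin 3) (LocalRing L v), ∀ g : (cmDatum L 3 H).Local v, ((ψ v g).val : GL (Fin 3) (LocalRing L v)) = S⁻¹ * g.val * S) ∧
      (∀ v (γ' : (cmDatum L 3 H).Local v),
        Corresponds (conjLocal L (IsCMField.complexConj L) v) ((adelicForm L 3 H).map (adeleToLocal L v))
          ((adelicForm L 3 (Matrix.of fun i j : Fin 3 => if i.val + j.val + 1 = 3 then (1 : L) else 0)).map (adeleToLocal L v))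
          γ' (ψ v γ')) ∧
      (∀ v (γ : (cmDatum L 3 (Matrix.of fun i j : Fin 3 => if i.val + j.val + 1 = 3 then (1 : L) else 0)).Local v),
        Corresponds (conjLocal L (IsCMField.complexConj L) v) ((adelicForm L 3 H).map (adeleToLocal L v))
          ((adelicForm L 3 (Matrix.of fun i j : Fin 3 => if i.val + j.val + 1 = 3 then (1 : L) else 0)).map (adeleToLocal L v))
          ((ψ v).symm γ) γ) ∧
      ∀ v ∉ S₀, ∀ g, ψ v g ∈ cmLocalIntegralLevel L 3 (Matrix.of fun i j : Fin 3 => if i.val + j.val + 1 = 3 then (1 : L) else 0) v ↔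
        g ∈ cmLocalIntegralLevel L 3 H v := by
  obtain ⟨ψ, S₀, hcongr, hlev⟩ := exists_psi_congr_forall_levelMatching L H hanis hherm
  refine ⟨ψ, S₀, fun v => ?_, fun v => ?_, fun v γ' => ?_, fun v γ => ?_, hlev⟩
  · obtain ⟨T, a, ha, h, hψ⟩ := hcongr v
    exact ⟨T, a, ha, h, hψ, fun g => by rw [hψ]; rfl⟩
  · obtain ⟨T, a, ha, h, hψ⟩ := hcongr v
    exact ⟨T, fun g => by rw [hψ]; rfl⟩
  · obtain ⟨T, a, ha, h, hψ⟩ := hcongr v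
    rw [hψ]
    exact corresponds_comm.1 (corresponds_cmDatumLocalCongr_symm L v T ha h γ')
  · obtain ⟨T, a, ha, h, hψ⟩ := hcongr v
    rw [hψ, ContinuousMulEquiv.symm_symm]
    exact corresponds_comm.1 (corresponds_cmDatumLocalCongr L v T ha h γ)

end UnitaryGroup

end Literature.NumberTheory.Automorphic

end
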